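import Summits.QuantumFields.YangMills.Theorems.BalabanUVNodesN19ClassSandwichRoad
import Literature.MathematicalPhysics.QuantumFieldTheory.Balaban1983to89.T4HybridMatching

/-!
# BalabanUVNodes ∕ N19 (NE7 proper) — ROAD (i) ⊂ ROAD (iii): the class-uniform POINTWISE density sandwich DENS_cl on a common reference measure gives NE7-S_cl for the
# `withDensity` class measures, the dressed `Spine.NE7.Core` for EVERY source `t` from the VACUUM sandwich DENS_cl⁰ (the observable's dressing `e^{tW}` is a common nonnegative
# factor), and road (ii)'s (I)-binder `TiltedMeanMatching` from the same data — lens decomp v7 §B (M27), the GENERIC half of ROW DENS-VAC (2)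

Cell `pub-ymgap` (HUMAN RULING D-0062, Track A), R134 ACCELERATION seat `pub-ymgap-dag-n19-d` (strategy s2), gen 7, module 27.  Lens decomp v7 (`ym-lens-BalabanUVNodes-decomp/LENS-decomp.md`
v7, [LENS-DECOMP-V7] INBOX l.16660: M27 ∕ F4; ROW DENS-VAC «→ NODE O lineage (instance owner) + dag-n19-d (consumer): (1) FORMAT CHECK (one line) … (2) If YES: state road (i)'s output
CENTRED and at `t`-free data as DENS_cl⁰ … and lift sketch v7 §B (:176–:358) into `Thm/BalabanUVNodesN19DensityRoad.lean`»; sketch `lean/LensDecompNE7v7.sketch.lean` §B farm rc 0) — §B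
LIFTED HERE decl by decl (CREDITED), plus §2 `vacuumDens_of_centring`, the GENERIC form of step (2a) («prove `hD` from `density_sandwich_of_centring`'s hypotheses at the vacuum data +
`TermBudget.deviation` via `sandwich_centre_uniform`»).  EVERYTHING HERE IS FORMAT-INDEPENDENT: the record-level APPLICATION (which reference measure, which densities — the
answer to the one-line format check (1)) is NOT typed here and waits on the NODE O instance owner; under (1) = NO the same theorems apply after the push-forward to `X` (n19-c
`classSandwich_map`, lens (3)).  Filed `--kind proof --supports stmt-QuantumFields-19912 --as helper` (K3‴; lane per lens V63).  COUNT-NEUTRAL.  THEOREMS ONLY; no Theses import; edits nothing.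

WHAT IS PROVED ([folklore] order arithmetic on reals, measures and integrals).
* §1 pointwise: `sandwich_mul_nonneg` (DRESSING INVARIANCE — a sandwich survives a COMMON nonnegative factor, the observable's dressing read by BOTH runs); centring before
  integrating is the tree's `T4RecentScale.sandwich_adjust` ∕ `sandwich_mono` (cited; the sketch's `sandwich_centre_uniform` is `sandwich_adjust` verbatim — not re-declared).
* §2 `vacuumDens_of_centring` — (2a) generic: road (i)'s pointwise term sandwiches at `t`-free data + radius budget + centre deviation ⇒ DENS_cl⁰ with ONE constant per `K`.
* §3 `classSandwich_withDensity_of_dens` (DENS_cl ⇒ NE7-S_cl for `withDensity` class measures; `ofReal` clamps, no sign∕measurability hypothesis) · `mgfForm_withDensity` (`withDensity` class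
  measures ARE MGF forms when the dressed class term is `∫ fA·e^{tW} dμ` — this seat's MODULE B identity at F3's objects is of this form) · `core_of_dens_direct` (road (i)'s last line in
  `Core`'s letters, everything `t`-indexed: the FUNCTION sandwich under one measure, `T4HybridMatching.integral_sandwich`) · ★ `core_dressed_of_vacuumDens` (ROAD (i) ⊂ ROAD (iii): the
  VACUUM pointwise sandwich DENS_cl⁰ + ONE observable family dressing both runs ⇒ the dressed `Spine.NE7.Core` for EVERY `t` through n19-c's landed `core_of_classSandwich` — the
  `t`-indexed half of a ledger is never read) · `shapeDensity_of_dens` (DENS ⇒ SHAPE in density form, clamped log-ratio) · ★ `tiltedMeanMatching_of_vacuumDens` (the (I)-binder of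
  road (ii) ∕ N14 from the same vacuum data, width `B·(e^{2 r_K} − 1)`, via n19-c's `tiltedMeanMatching_of_shapeDensity`).

HONEST FRAMING.  ZERO ESTIMATE CONTENT: DENS_cl⁰ (the class-uniform pointwise sandwich of the two runs' vacuum class densities) is NE7's residual in road (i)'s letters — an UNPRINTED
two-run statement for d = 4 (lens v3–v7; lit-balaban ROWS [I] Thm 1 ∕ (1.7) ∕ (1.18)–(1.21), [II] §3 (3.43)–(3.46) are one-run), produced by nobody; every sandwich here is a HYPOTHESIS
SHAPE; whether NODE O's ledger instance has the `t`-free format is the open one-line check (1); nothing of Bałaban's is instantiated; NE7 ∕ NE1′ NOT PROVED; N19 NOT discharged (0∕1);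
K3‴ NOT claimed; counts UNMOVED (typed 28∕28 · discharged 5∕27, A 5∕28); one finite four-torus programme at fixed `ε = L^{−K}` — NOT ℝ⁴, NOT infinite volume, NOT OS, NOT a mass gap,
NOT Clay.  0 `def`; 0 `sorry`; standard axioms; no decl below carries a cite tag.
-/

set_option autoImplicit false

noncomputable section

open MeasureTheory ProbabilityTheory
open scoped ENNReal

namespace Summit.QuantumFields.YangMills.BalabanUVNodes.N19DensityRoad

open Summit.QuantumFields.BalabanUV.T4Continuum.NE1p.DressedMGFForm (tiltedMean MGFForm TiltedMeanMatching)
open Summit.QuantumFields.BalabanUV.T4Continuum.Spine.NE7 (Core)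
open Summit.QuantumFields.YangMills.BalabanUVNodes.N19ClassSandwichRoad
open Literature.MathematicalPhysics.QuantumFieldTheory.Balaban1983to89

/-! ## §1 Pointwise: dressing invariance and centring before integrating (lens v7 sketch §B) -/

section Pointwise

/-- **DRESSING INVARIANCE** (pointwise): a two-sided sandwich `e^{c−r}·a ≤ b ≤ e^{c+r}·a` survives a COMMON nonnegative factor `h`
(the observable's dressing `e^{tW(v)}` read by BOTH runs on the common unit-lattice variable — lens v6 F1 ∕ lens control (OBS)). Lens v7 sketch §B, lifted. [folklore] -/
theorem sandwich_mul_nonneg {a b h c r : ℝ} (hlo : Real.exp (c - r) * a ≤ b) (hhi : b ≤ Real.exp (c + r) * a) (hh : 0 ≤ h) :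
    Real.exp (c - r) * (h * a) ≤ h * b ∧ h * b ≤ Real.exp (c + r) * (h * a) := by
  constructor
  · calc Real.exp (c - r) * (h * a) = h * (Real.exp (c - r) * a) := by ring
      _ ≤ h * b := mul_le_mul_of_nonneg_left hlo hh
  · calc h * b ≤ h * (Real.exp (c + r) * a) := mul_le_mul_of_nonneg_left hhi hh
      _ = Real.exp (c + r) * (h * a) := by ring

/- CENTRING BEFORE INTEGRATING (pointwise) IS ALREADY IN THE TREE: `T4RecentScale.sandwich_adjust` (a sandwich with the term's OWN centre `Cτ` and radius `Rτ`, `0 ≤ a`,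
`|Cτ − c| ≤ s` ⇒ centre `c`, radius `Rτ + s`) and `T4RecentScale.sandwich_mono` (radius monotonicity) — cited by name in §2 (lens v7 sketch §B's `sandwich_centre_uniform` is
`sandwich_adjust` verbatim; not re-declared, gate `dedup.landed`). -/

end Pointwise

/-! ## §2 ROW DENS-VAC (2a), generic: DENS_cl⁰ from road (i)'s pointwise data centred before integrating -/

section Centring

variable {ι : Type*} [DecidableEq ι] {Ω : ℕ → Type*} [∀ K, MeasurableSpace (Ω K)] {l₀ : ℝ} {T : ℕ → Finset ι}
  {Bad : ℕ → ℝ → Finset ι} {μ : ∀ K, ι → Measure (Ω K)} {fA fB : ∀ K, ι → Ω K → ℝ} {Cc Rr : ℕ → ι → ℝ} {c₀ R d : ℕ → ℝ}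

/-- **ROW DENS-VAC (2a), GENERIC: DENS_cl⁰ FROM ROAD (i)'s POINTWISE DATA CENTRED BEFORE INTEGRATING.**  If on every class good at an admissible source the two
runs' VACUUM densities are sandwiched a.e. with the TERM's own (`t`-free) centre `Cc K τ` and radius `Rr K τ` and `0 ≤ fA` (the pointwise output of road (i),
`T4TermwiseBudget.density_sandwich_of_centring`, read at `t`-free data), the radii are budgeted `Rr K τ ≤ R K` and the centres deviate from a CLASS-UNIFORM `c₀ K` by at most
`d K` (`T4GoodClassBudget.TermBudget.remainder` ∕ `.deviation` in pointwise guise), then DENS_cl⁰ holds with ONE constant `c₀ K` per `K` and width `R K + d K` — the `hD` of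
`core_dressed_of_vacuumDens` below (`T4RecentScale.sandwich_adjust` + `sandwich_mono` a.e.).  What NODE O's vacuum instance must hand, in pointwise letters; nothing produced here. [folklore] -/
theorem vacuumDens_of_centring
    (hpt : ∀ (K : ℕ) (t : ℝ), |t| ≤ l₀ → ∀ τ ∈ T K \ Bad K t, ∀ᵐ ω ∂(μ K τ),
      0 ≤ fA K τ ω ∧ Real.exp (Cc K τ - Rr K τ) * fA K τ ω ≤ fB K τ ω ∧ fB K τ ω ≤ Real.exp (Cc K τ + Rr K τ) * fA K τ ω)
    (hR : ∀ (K : ℕ) (t : ℝ), |t| ≤ l₀ → ∀ τ ∈ T K \ Bad K t, Rr K τ ≤ R K)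
    (hdev : ∀ (K : ℕ) (t : ℝ), |t| ≤ l₀ → ∀ τ ∈ T K \ Bad K t, |Cc K τ - c₀ K| ≤ d K) :
    ∀ K : ℕ, ∃ c : ℝ, ∀ t : ℝ, |t| ≤ l₀ → ∀ τ ∈ T K \ Bad K t, ∀ᵐ ω ∂(μ K τ),
      Real.exp (c - (R K + d K)) * fA K τ ω ≤ fB K τ ω ∧ fB K τ ω ≤ Real.exp (c + (R K + d K)) * fA K τ ω := by
  intro K
  refine ⟨c₀ K, fun t ht τ hτ => (hpt K t ht τ hτ).mono fun ω hω => ?_⟩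
  obtain ⟨h0, hlo, hhi⟩ := hω
  obtain ⟨h1, h2⟩ := T4RecentScale.sandwich_adjust h0 hlo hhi (hdev K t ht τ hτ)
  exact T4RecentScale.sandwich_mono h0 h1 h2 (by linarith [hR K t ht τ hτ])

end Centring

/-! ## §3 DENS_cl ⇒ NE7-S_cl ⇒ dressed `Core`; DENS ⇒ SHAPE ⇒ the (I)-binder (lens v7 sketch §B) -/

section Dens

variable {ι : Type*} [DecidableEq ι] {Ω : ℕ → Type*} [∀ K, MeasurableSpace (Ω K)] {l₀ vol B : ℝ} {T : ℕ → Finset ι}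
  {Bad : ℕ → ℝ → Finset ι} {W : ∀ K, Ω K → ℝ} {μ : ∀ K, ι → Measure (Ω K)} {fA fB : ∀ K, ι → Ω K → ℝ}
  {P Q : ℕ → ℝ → ι → ℝ} {r δ : ℕ → ℝ}

/-- **DENS_cl ⇒ NE7-S_cl** for the `withDensity` class measures: a class-uniform POINTWISE (a.e.) sandwich of two real densities on a COMMON
reference measure `μ K τ` — `e^{c − r_K}·fA ≤ fB ≤ e^{c + r_K}·fA`, ONE `c` per `K` — gives the class-level MEASURE sandwich NE7-S_cl (spelled
out as in the landed road (iii)) for `(μ K τ).withDensity (ofReal ∘ fA K τ)` ∕ `(μ K τ).withDensity (ofReal ∘ fB K τ)`, same width, same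
constant (Mathlib `withDensity_mono`, `withDensity_smul'`; no sign or measurability hypothesis — `ofReal` clamps). Lens v7 sketch §B, lifted. [folklore] -/
theorem classSandwich_withDensity_of_dens
    (hD : ∀ K : ℕ, ∃ c : ℝ, ∀ t : ℝ, |t| ≤ l₀ → ∀ τ ∈ T K \ Bad K t, ∀ᵐ ω ∂(μ K τ),
      Real.exp (c - r K) * fA K τ ω ≤ fB K τ ω ∧ fB K τ ω ≤ Real.exp (c + r K) * fA K τ ω) :
    ∀ K : ℕ, ∃ c : ℝ, ∀ t : ℝ, |t| ≤ l₀ → ∀ τ ∈ T K \ Bad K t,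
      ENNReal.ofReal (Real.exp (c - r K)) • (μ K τ).withDensity (fun ω => ENNReal.ofReal (fA K τ ω)) ≤
          (μ K τ).withDensity (fun ω => ENNReal.ofReal (fB K τ ω)) ∧
        (μ K τ).withDensity (fun ω => ENNReal.ofReal (fB K τ ω)) ≤
          ENNReal.ofReal (Real.exp (c + r K)) • (μ K τ).withDensity (fun ω => ENNReal.ofReal (fA K τ ω)) := by
  intro K
  obtain ⟨c, hc⟩ := hD K
  refine ⟨c, fun t ht τ hτ => ?_⟩
  have h := hc t ht τ hτ
  constructor
  · rw [← withDensity_smul' _ _ ENNReal.ofReal_ne_top]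
    refine withDensity_mono (h.mono fun ω hω => ?_)
    show ENNReal.ofReal (Real.exp (c - r K)) * ENNReal.ofReal (fA K τ ω) ≤ ENNReal.ofReal (fB K τ ω)
    rw [← ENNReal.ofReal_mul (Real.exp_pos _).le]
    exact ENNReal.ofReal_le_ofReal hω.1
  · rw [← withDensity_smul' _ _ ENNReal.ofReal_ne_top]
    refine withDensity_mono (h.mono fun ω hω => ?_)
    show ENNReal.ofReal (fB K τ ω) ≤ ENNReal.ofReal (Real.exp (c + r K)) * ENNReal.ofReal (fA K τ ω)
    rw [← ENNReal.ofReal_mul (Real.exp_pos _).le]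
    exact ENNReal.ofReal_le_ofReal hω.2

omit [DecidableEq ι] in
/-- **`withDensity` CLASS MEASURES ARE MGF FORMS**: if the dressed class term is `P K t τ = ∫ fA·e^{tW_K} dμ` (the observable's dressing an
explicit factor against a `t`-FREE density `fA K τ ≥ 0` on a `t`-FREE reference measure — dag-n19-d MODULE B's identity
`classWeightOfDatum₉ … t s = mgf (prodObs …) (classMeasureOfSlots …) t`, ALL `t`, is this at F3's objects), then
`MGFForm B T W (K τ ↦ (μ K τ).withDensity (ofReal ∘ fA K τ)) P` (t4 `T4VarianceMatching.integral_withDensity_ofReal_mul`,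
Mathlib `isFiniteMeasure_withDensity_ofReal`). Lens v7 sketch §B, lifted. [folklore] -/
theorem mgfForm_withDensity (hB : 0 ≤ B) (hWm : ∀ K, Measurable (W K)) (hWb : ∀ K ω, |W K ω| ≤ B)
    (hfm : ∀ K τ, Measurable (fA K τ)) (hf0 : ∀ K τ ω, 0 ≤ fA K τ ω) (hfi : ∀ K, ∀ τ ∈ T K, Integrable (fA K τ) (μ K τ))
    (hP : ∀ K (t : ℝ), ∀ τ ∈ T K, P K t τ = ∫ ω, fA K τ ω * Real.exp (t * W K ω) ∂(μ K τ)) :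
    MGFForm B T W (fun K τ => (μ K τ).withDensity fun ω => ENNReal.ofReal (fA K τ ω)) P where
  nonneg := hB
  meas := hWm
  bound := hWb
  finite K τ hτ := isFiniteMeasure_withDensity_ofReal (hfi K τ hτ).hasFiniteIntegral
  repr K t τ hτ := by
    rw [hP K t τ hτ]
    simp only [mgf]
    exact (T4VarianceMatching.integral_withDensity_ofReal_mul (hfm K τ) (hf0 K τ) _).symm

/-- **ROAD (i)'s LAST LINE, in `Core`'s letters** (generic, everything `t`-indexed — NODE O's ledger format: BOTH runs' class terms are integrals
of densities `gA, gB` against ONE reference measure `μ K t τ`; tree: `T4TermwiseBudget.term_sandwich_of_centring` + `T4GoodClassBudget.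
goodClause_of_termBudget`, re-keyed): the class-uniform POINTWISE sandwich DENS_cl ⇒ `Core`, by the FUNCTION sandwich under one measure
(`T4HybridMatching.integral_sandwich`) — no measure on `X`, no MGF form, no (V), no (I). Lens v7 sketch §B, lifted. [folklore] -/
theorem core_of_dens_direct {μt : ∀ K, ℝ → ι → Measure (Ω K)} {gA gB : ∀ K, ℝ → ι → Ω K → ℝ}
    (hP : ∀ K t, |t| ≤ l₀ → ∀ τ ∈ T K \ Bad K t, P K t τ = ∫ ω, gA K t τ ω ∂(μt K t τ))
    (hQ : ∀ K t, |t| ≤ l₀ → ∀ τ ∈ T K \ Bad K t, Q K t τ = ∫ ω, gB K t τ ω ∂(μt K t τ))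
    (hint : ∀ K t, |t| ≤ l₀ → ∀ τ ∈ T K \ Bad K t, Integrable (gA K t τ) (μt K t τ) ∧ Integrable (gB K t τ) (μt K t τ))
    (hA0 : ∀ K t, |t| ≤ l₀ → ∀ τ ∈ T K \ Bad K t, 0 ≤ᵐ[μt K t τ] gA K t τ)
    (hD : ∀ K : ℕ, ∃ c : ℝ, ∀ t : ℝ, |t| ≤ l₀ → ∀ τ ∈ T K \ Bad K t, ∀ᵐ ω ∂(μt K t τ),
      Real.exp (c - r K) * gA K t τ ω ≤ gB K t τ ω ∧ gB K t τ ω ≤ Real.exp (c + r K) * gA K t τ ω)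
    (hr : ∀ K, r K ≤ vol * δ K) : Core l₀ vol T Bad P Q δ := by
  intro K
  obtain ⟨c, hc⟩ := hD K
  refine ⟨c, fun t ht τ hτ => ?_⟩
  obtain ⟨hiA, hiB⟩ := hint K t ht τ hτ
  have h := hc t ht τ hτ
  obtain ⟨h1, h2⟩ := T4HybridMatching.integral_sandwich hiA hiB (h.mono fun ω hω => hω.1) (h.mono fun ω hω => hω.2)
  have hPnn : 0 ≤ ∫ ω, gA K t τ ω ∂(μt K t τ) := integral_nonneg_of_ae (hA0 K t ht τ hτ)
  rw [hP K t ht τ hτ, hQ K t ht τ hτ]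
  constructor
  · calc Real.exp (c - vol * δ K) * ∫ ω, gA K t τ ω ∂(μt K t τ) ≤ Real.exp (c - r K) * ∫ ω, gA K t τ ω ∂(μt K t τ) :=
          mul_le_mul_of_nonneg_right (Real.exp_le_exp.2 (by linarith [hr K])) hPnn
      _ ≤ _ := h1
  · calc ∫ ω, gB K t τ ω ∂(μt K t τ) ≤ Real.exp (c + r K) * ∫ ω, gA K t τ ω ∂(μt K t τ) := h2
      _ ≤ Real.exp (c + vol * δ K) * ∫ ω, gA K t τ ω ∂(μt K t τ) :=
          mul_le_mul_of_nonneg_right (Real.exp_le_exp.2 (by linarith [hr K])) hPnn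

/-- **★ ROAD (i) ⊂ ROAD (iii) — THE DRESSED `Core` FROM THE VACUUM POINTWISE SANDWICH.**  `t`-FREE reference measures `μ K τ`, `t`-FREE
densities `fA, fB ≥ 0` (the two runs' VACUUM class densities on the common unit-lattice variable), ONE observable family `W_K` (`|W| ≤ B`)
dressing BOTH runs by the explicit factor `e^{tW}`, and the VACUUM class-uniform pointwise sandwich DENS_cl⁰
`e^{c − r_K}·fA ≤ fB ≤ e^{c + r_K}·fA` a.e. on every class good at an admissible source ⇒ `Spine.NE7.Core l₀ vol T Bad P Q δ` for EVERY `t`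
(`r K ≤ vol·δ K`): DENS_cl⁰ ⇒ NE7-S_cl (`classSandwich_withDensity_of_dens`) ⇒ landed road (iii) `core_of_classSandwich` with the two
`withDensity` MGF forms (`mgfForm_withDensity`).  The `t`-indexed half of the ledger is never read. Lens v7 sketch §B, lifted. [folklore] -/
theorem core_dressed_of_vacuumDens (hB : 0 ≤ B) (hWm : ∀ K, Measurable (W K)) (hWb : ∀ K ω, |W K ω| ≤ B)
    (hfAm : ∀ K τ, Measurable (fA K τ)) (hfA0 : ∀ K τ ω, 0 ≤ fA K τ ω) (hfAi : ∀ K, ∀ τ ∈ T K, Integrable (fA K τ) (μ K τ))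
    (hfBm : ∀ K τ, Measurable (fB K τ)) (hfB0 : ∀ K τ ω, 0 ≤ fB K τ ω) (hfBi : ∀ K, ∀ τ ∈ T K, Integrable (fB K τ) (μ K τ))
    (hP : ∀ K (t : ℝ), ∀ τ ∈ T K, P K t τ = ∫ ω, fA K τ ω * Real.exp (t * W K ω) ∂(μ K τ))
    (hQ : ∀ K (t : ℝ), ∀ τ ∈ T K, Q K t τ = ∫ ω, fB K τ ω * Real.exp (t * W K ω) ∂(μ K τ))
    (hD : ∀ K : ℕ, ∃ c : ℝ, ∀ t : ℝ, |t| ≤ l₀ → ∀ τ ∈ T K \ Bad K t, ∀ᵐ ω ∂(μ K τ),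
      Real.exp (c - r K) * fA K τ ω ≤ fB K τ ω ∧ fB K τ ω ≤ Real.exp (c + r K) * fA K τ ω)
    (hr : ∀ K, r K ≤ vol * δ K) : Core l₀ vol T Bad P Q δ :=
  core_of_classSandwich (mgfForm_withDensity hB hWm hWb hfAm hfA0 hfAi hP) (mgfForm_withDensity hB hWm hWb hfBm hfB0 hfBi hQ)
    (classSandwich_withDensity_of_dens hD) hr

/-- **DENS ⇒ SHAPE IN DENSITY FORM** (one class): an a.e. pointwise sandwich `e^{c−r}·fA ≤ fB ≤ e^{c+r}·fA` of measurable real densities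
(`0 ≤ r`) exhibits `μ.withDensity fB = e^{c}·(μ.withDensity fA).withDensity e^{g}` with `g` measurable and `|g| ≤ r` EVERYWHERE (`g` = the
log-ratio minus `c`, clamped to `[−r, r]`; where `fA ≤ 0` both densities vanish).  This is the hypothesis of the landed
`tiltedMeanMatching_of_shapeDensity` ∕ `shapeSandwich_of_shapeDensity`. Lens v7 sketch §B, lifted. [folklore] -/
theorem shapeDensity_of_dens {α : Type*} [MeasurableSpace α] {μ : Measure α} {f g₂ : α → ℝ} {c r : ℝ} (hr : 0 ≤ r)
    (hfm : Measurable f) (hgm : Measurable g₂)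
    (hD : ∀ᵐ x ∂μ, Real.exp (c - r) * f x ≤ g₂ x ∧ g₂ x ≤ Real.exp (c + r) * f x) :
    ∃ g : α → ℝ, Measurable g ∧ (∀ x, |g x| ≤ r) ∧
      μ.withDensity (fun x => ENNReal.ofReal (g₂ x)) =
        ENNReal.ofReal (Real.exp c) • (μ.withDensity fun x => ENNReal.ofReal (f x)).withDensity
          fun x => ENNReal.ofReal (Real.exp (g x)) := by
  -- the clamped log-ratio
  set g : α → ℝ := fun x => max (-r) (min r (Real.log (g₂ x) - Real.log (f x) - c)) with hg
  have hgmeas : Measurable g :=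
    measurable_const.max (measurable_const.min (((Real.measurable_log.comp hgm).sub (Real.measurable_log.comp hfm)).sub
      measurable_const))
  have hgb : ∀ x, |g x| ≤ r := fun x => by
    rw [abs_le]
    exact ⟨le_max_left _ _, max_le (by linarith) (min_le_left _ _)⟩
  refine ⟨g, hgmeas, hgb, ?_⟩
  rw [← withDensity_mul _ (by fun_prop) (by fun_prop), ← withDensity_smul' _ _ ENNReal.ofReal_ne_top]
  refine withDensity_congr_ae (hD.mono fun x hx => ?_)
  show ENNReal.ofReal (g₂ x) = ENNReal.ofReal (Real.exp c) * (ENNReal.ofReal (f x) * ENNReal.ofReal (Real.exp (g x)))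
  rcases le_or_gt (f x) 0 with hf0 | hfpos
  · -- both densities vanish
    have hg0 : g₂ x ≤ 0 := hx.2.trans (mul_nonpos_of_nonneg_of_nonpos (Real.exp_pos _).le hf0)
    rw [ENNReal.ofReal_of_nonpos hg0, ENNReal.ofReal_of_nonpos hf0, zero_mul, mul_zero]
  · have hg₂pos : 0 < g₂ x := lt_of_lt_of_le (mul_pos (Real.exp_pos _) hfpos) hx.1
    -- the clamp is inactive: the log-ratio minus `c` lies in `[−r, r]`
    have hlo : -r ≤ Real.log (g₂ x) - Real.log (f x) - c := by
      have := Real.log_le_log (mul_pos (Real.exp_pos _) hfpos) hx.1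
      rw [Real.log_mul (Real.exp_pos _).ne' hfpos.ne', Real.log_exp] at this
      linarith
    have hhi : Real.log (g₂ x) - Real.log (f x) - c ≤ r := by
      have := Real.log_le_log hg₂pos hx.2
      rw [Real.log_mul (Real.exp_pos _).ne' hfpos.ne', Real.log_exp] at this
      linarith
    have hgx : g x = Real.log (g₂ x) - Real.log (f x) - c := by
      rw [hg]; simp only
      rw [min_eq_right hhi, max_eq_right hlo]
    rw [← ENNReal.ofReal_mul hfpos.le, ← ENNReal.ofReal_mul (Real.exp_pos _).le, hgx]
    congr 1
    rw [show Real.log (g₂ x) - Real.log (f x) - c = Real.log (g₂ x) - (Real.log (f x) + c) by ring, Real.exp_sub, Real.exp_add,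
      Real.exp_log hg₂pos, Real.exp_log hfpos]
    field_simp

/-- **★ THE (I)-BINDER FROM THE VACUUM POINTWISE SANDWICH** (road (ii)'s second input is ALSO a shadow of road (i)'s data): DENS_cl⁰ (even with a
per-class constant) for measurable densities on `t`-free finite reference pieces ⇒ `TiltedMeanMatching l₀ T Bad W μA W μB (K ↦ B·(e^{2 r_K} − 1))`
for the `withDensity` class measures — `shapeDensity_of_dens` + the landed `tiltedMeanMatching_of_shapeDensity` (n14-c J §1 inside). Lens v7 sketch §B, lifted. [folklore] -/
theorem tiltedMeanMatching_of_vacuumDens (hr : ∀ K, 0 ≤ r K) (hB : 0 ≤ B) (hWm : ∀ K, Measurable (W K))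
    (hWb : ∀ K ω, |W K ω| ≤ B) (hfAm : ∀ K τ, Measurable (fA K τ)) (hfBm : ∀ K τ, Measurable (fB K τ))
    (hfAi : ∀ K, ∀ τ ∈ T K, Integrable (fA K τ) (μ K τ))
    (hD : ∀ (K : ℕ) (t : ℝ), |t| ≤ l₀ → ∀ τ ∈ T K \ Bad K t, ∃ c : ℝ, ∀ᵐ ω ∂(μ K τ),
      Real.exp (c - r K) * fA K τ ω ≤ fB K τ ω ∧ fB K τ ω ≤ Real.exp (c + r K) * fA K τ ω) :
    TiltedMeanMatching l₀ T Bad W (fun K τ => (μ K τ).withDensity fun ω => ENNReal.ofReal (fA K τ ω)) W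
      (fun K τ => (μ K τ).withDensity fun ω => ENNReal.ofReal (fB K τ ω)) fun K => B * (Real.exp (2 * r K) - 1) := by
  refine tiltedMeanMatching_of_shapeDensity (fun K t ht τ hτ => ?_) hr hB
    (fun K τ hτ => isFiniteMeasure_withDensity_ofReal (hfAi K τ hτ).hasFiniteIntegral) hWm hWb
  obtain ⟨c, hc⟩ := hD K t ht τ hτ
  obtain ⟨g, hgm, hgb, hEq⟩ := shapeDensity_of_dens (μ := μ K τ) (hr K) (hfAm K τ) (hfBm K τ) hc
  exact ⟨c, g, hgm, hgb, hEq⟩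

end Dens

end Summit.QuantumFields.YangMills.BalabanUVNodes.N19DensityRoad

end
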